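import Summits.AtomisticToContinuum.HydrodynamicLimit.Theorems.InformationPercolationEngineChaosClosesEulerShellWeights
import Summits.AtomisticToContinuum.HydrodynamicLimit.Theorems.JaynesSqueezeEntropicWeakStrongHSShellA
import HarnessLib

/-!
# BF18 shell for functions (crux `ChaosClosesEuler`, stmt-AtomisticToContinuum-15141, line `Sketch`,
# stub `stub_bf18Shell`) — helper 2b: the windowed Grönwall bookkeeping

WHAT. `window_gronwall`: a non-negative bounded measurable `F` on `[0, t]` (the space integral of the clamped
relative energy) which satisfies, for every window start `τ₀ ∈ [0, t − Δ]`, the WEIGHTED inequality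
`∫₀ᵗ w_{τ₀}(s) F(s) ds ≤ A + C⋆ ∫₀^{τ₀+Δ} F` with the weight `w_{τ₀}(s) = −∂ₛ ζ((τ₀ + Δ − s)/Δ)`
(`ζ = Real.smoothTransition`; `w_{τ₀} ≥ 0` is a smooth probability density on the window `[τ₀, τ₀ + Δ]`), obeys
the UNWEIGHTED window bound `∫_{τ₀}^{τ₀+Δ} F ≤ Δ·[(2 + 1/(1 − ζ(1−u)) + 1/ζ(u))·(A + C⋆ B_I) + C₂ u]` for
every `u ∈ (0,1)`, where `B_I = (C₂Δ + t(A + C⋆C₂Δ))e^{C⋆t} + C₂Δ` bounds `∫₀ᵗ F` and `C₂` bounds `F`.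
As `A, Δ → 0` at fixed `u` the bracket tends to `C₂ u`: this is how the shell turns defects `δ` and short
windows into a small time-averaged relative energy.

PROOF. With `I(τ) = ∫₀^τ F` and `G(τ') = ∫ w_{τ'} F ≤ A + C⋆ I(τ'+Δ)`: averaging over `τ' ∈ [α, β]` gives
`I(β) − I(α+Δ) ≤ ∫_α^β G` (helper 2a: the averaged weight is `≡ 1` on `[α+Δ, β]`), hence the linear integral
inequality `I(β) ≤ C₂Δ + t(A + C⋆C₂Δ) + C⋆∫₀^β I` on `[0, t−Δ]` (the a-priori `I(τ'+Δ) ≤ I(τ') + C₂Δ`), so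
Grönwall bounds `I(t) ≤ B_I`; bulk windows `τ₀ ∈ [Δ, t−2Δ]` are averaged over `[τ₀−Δ, τ₀+Δ]`; the first and the
last window use `F ≤ C₂` on a fraction `u` of the window and the weights `1 − ζ(1−u)`, `ζ(u) > 0` on the rest.

No named fact is invoked.
-/

noncomputable section

namespace Summit.AtomisticToContinuum.HydrodynamicLimit.Theorems.ChaosClosesEulerShell

open Set MeasureTheory
open scoped Topology

/-- **The windowed Grönwall lemma, core form** (global bounds `0 ≤ F ≤ C₂`): see `window_gronwall`.
[folklore] -/
theorem window_gronwall_core {F : ℝ → ℝ} (hF : Measurable F) {t Δ A Cs C₂ u : ℝ}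
    (hΔ : 0 < Δ) (hΔt : 4 * Δ ≤ t) (hA : 0 ≤ A) (hCs : 0 ≤ Cs) (hC₂ : 0 ≤ C₂)
    (hu0 : 0 < u) (hu1 : u < 1) (hF0 : ∀ s, 0 ≤ F s) (hFb : ∀ s, F s ≤ C₂)
    (hwin : ∀ τ₀ ∈ Icc 0 (t - Δ),
      ∫ s in Icc 0 t, -deriv (fun s' => Real.smoothTransition ((τ₀ + Δ - s') / Δ)) s * F s
        ≤ A + Cs * ∫ s in Icc 0 (τ₀ + Δ), F s) :
    ∀ τ₀ ∈ Icc 0 (t - Δ), ∫ s in Icc τ₀ (τ₀ + Δ), F s ≤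
      Δ * ((2 + 1 / (1 - Real.smoothTransition (1 - u)) + 1 / Real.smoothTransition u) *
        (A + Cs * ((C₂ * Δ + t * (A + Cs * C₂ * Δ)) * Real.exp (Cs * t) + C₂ * Δ)) + C₂ * u) := by
  have ht : 0 < t := by linarith
  have hFabs : ∀ s, |F s| ≤ C₂ := fun s => by rw [abs_of_nonneg (hF0 s)]; exact hFb s
  -- integrability
  have hFi : ∀ S : Set ℝ, volume S ≠ ⊤ → IntegrableOn F S volume := fun S hS =>
    Measure.integrableOn_of_bounded (M := C₂) hS hF.aestronglyMeasurable
      (Filter.Eventually.of_forall fun s => by rw [Real.norm_eq_abs]; exact hFabs s)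
  have hFii : ∀ a b : ℝ, IntervalIntegrable F volume a b := fun a b =>
    (hFi (uIcc a b) (by rw [uIcc, Real.volume_Icc]; exact ENNReal.ofReal_ne_top)).intervalIntegrable
  -- the primitive
  set I : ℝ → ℝ := fun τ => ∫ s in (0 : ℝ)..τ, F s with hI
  have hIc : Continuous I := intervalIntegral.continuous_primitive hFii 0
  have hI_Icc : ∀ τ, 0 ≤ τ → I τ = ∫ s in Icc 0 τ, F s := fun τ hτ => by
    simp only [hI]; rw [intervalIntegral.integral_of_le hτ, integral_Icc_eq_integral_Ioc]
  have hIdiff : ∀ a b, a ≤ b → I b - I a = ∫ s in Icc a b, F s := fun a b hab => by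
    simp only [hI]
    rw [intervalIntegral.integral_interval_sub_left (hFii 0 b) (hFii 0 a),
      intervalIntegral.integral_of_le hab, integral_Icc_eq_integral_Ioc]
  have hI0 : I 0 = 0 := by simp [hI]
  have hwindow_nonneg : ∀ a b, 0 ≤ ∫ s in Icc a b, F s := fun a b =>
    setIntegral_nonneg measurableSet_Icc fun s _ => hF0 s
  have hwindow_le : ∀ a b, a ≤ b → ∫ s in Icc a b, F s ≤ C₂ * (b - a) := fun a b hab => by
    have h1 : ∫ s in Icc a b, F s ≤ ∫ _ in Icc a b, C₂ :=
      setIntegral_mono_on (hFi _ measure_Icc_lt_top.ne) (continuousOn_const.integrableOn_Icc)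
        measurableSet_Icc fun s _ => hFb s
    rw [setIntegral_const, smul_eq_mul, Measure.real, Real.volume_Icc,
      ENNReal.toReal_ofReal (by linarith)] at h1
    linarith
  have hImono : ∀ a b, a ≤ b → I a ≤ I b := fun a b hab => by
    have := hIdiff a b hab; linarith [hwindow_nonneg a b]
  have hIlip : ∀ a b, a ≤ b → I b - I a ≤ C₂ * (b - a) := fun a b hab => by
    rw [hIdiff a b hab]; exact hwindow_le a b hab
  have hInn : ∀ τ, 0 ≤ τ → 0 ≤ I τ := fun τ hτ => by have := hImono 0 τ hτ; rwa [hI0] at this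
  -- the weighted inequality in terms of `I`
  set G : ℝ → ℝ := fun τ' => ∫ s in Icc 0 t,
    -deriv (fun s' => Real.smoothTransition ((τ' + Δ - s') / Δ)) s * F s with hG
  have hGle : ∀ τ' ∈ Icc 0 (t - Δ), G τ' ≤ A + Cs * I (τ' + Δ) := fun τ' hτ' => by
    rw [hI_Icc _ (by linarith [hτ'.1])]; exact hwin τ' hτ'
  -- averaging identity and the two uses of it
  have havg : ∀ α β, α ≤ β → IntegrableOn G (Icc α β) volume ∧
      ∫ τ' in Icc α β, G τ' = ∫ s in Icc 0 t, (Real.smoothTransition ((β + Δ - s) / Δ) -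
        Real.smoothTransition ((α + Δ - s) / Δ)) * F s := fun α β hαβ =>
    integral_integral_weight hF hFabs hαβ t Δ
  have hlow : ∀ α β m : ℝ, α ≤ β → ∀ J : Set ℝ, MeasurableSet J → J ⊆ Icc 0 t →
      (∀ s ∈ J, m ≤ Real.smoothTransition ((β + Δ - s) / Δ) -
        Real.smoothTransition ((α + Δ - s) / Δ)) →
      m * ∫ s in J, F s ≤ ∫ τ' in Icc α β, G τ' := fun α β m hαβ J hJ hJt hJm => by
    rw [(havg α β hαβ).2]; exact weighted_lower_bound hF hF0 hFabs hαβ hΔ hJ hJt hJm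
  have hup : ∀ α β Q : ℝ, 0 ≤ α → α ≤ β → β ≤ t - Δ → (∀ τ' ∈ Icc α β, G τ' ≤ Q) →
      ∫ τ' in Icc α β, G τ' ≤ (β - α) * Q := fun α β Q hα hαβ hβ hQ => by
    have h1 : ∫ τ' in Icc α β, G τ' ≤ ∫ _ in Icc α β, Q :=
      setIntegral_mono_on (havg α β hαβ).1 (continuousOn_const.integrableOn_Icc) measurableSet_Icc hQ
    rw [setIntegral_const, smul_eq_mul, Measure.real, Real.volume_Icc,
      ENNReal.toReal_ofReal (by linarith)] at h1
    linarith
  -- the plain-weight facts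
  have hcut_one : ∀ β s : ℝ, s ≤ β → Real.smoothTransition ((β + Δ - s) / Δ) = 1 := fun β s hs =>
    Real.smoothTransition.one_of_one_le (by rw [le_div_iff₀ hΔ]; linarith)
  have hcut_zero : ∀ α s : ℝ, α + Δ ≤ s → Real.smoothTransition ((α + Δ - s) / Δ) = 0 := fun α s hs =>
    Real.smoothTransition.zero_of_nonpos (div_nonpos_of_nonpos_of_nonneg (by linarith) hΔ.le)
  have hbulk_weight : ∀ α β : ℝ, ∀ s ∈ Icc (α + Δ) β,
      (1 : ℝ) ≤ Real.smoothTransition ((β + Δ - s) / Δ) - Real.smoothTransition ((α + Δ - s) / Δ) :=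
    fun α β s hs => by rw [hcut_one β s hs.2, hcut_zero α s hs.1]; norm_num
  -- Step 1: Grönwall for `I` on `[0, t - Δ]`
  set a₀ : ℝ := C₂ * Δ + t * (A + Cs * C₂ * Δ) with ha₀
  have ha₀nn : 0 ≤ a₀ := by positivity
  have hIΔ : I Δ ≤ C₂ * Δ := by have := hIlip 0 Δ hΔ.le; rw [hI0] at this; linarith
  have hGle' : ∀ τ' ∈ Icc 0 (t - Δ), G τ' ≤ (A + Cs * C₂ * Δ) + Cs * I τ' := fun τ' hτ' => by
    have h1 := hGle τ' hτ'
    have h2 : I (τ' + Δ) ≤ I τ' + C₂ * Δ := by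
      have := hIlip τ' (τ' + Δ) (by linarith); linarith
    nlinarith
  have hle : ∀ β ∈ Icc 0 (t - Δ), I β ≤ a₀ + Cs * ∫ τ' in (0 : ℝ)..β, I τ' := by
    intro β hβ
    have hIi : ∀ a b : ℝ, IntervalIntegrable I volume a b := fun a b => hIc.intervalIntegrable a b
    have hint_nn : 0 ≤ ∫ τ' in (0 : ℝ)..β, I τ' :=
      intervalIntegral.integral_nonneg hβ.1 fun τ' hτ' => hInn τ' hτ'.1
    have hCsint : 0 ≤ Cs * ∫ τ' in (0 : ℝ)..β, I τ' := mul_nonneg hCs hint_nn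
    have htA : 0 ≤ t * (A + Cs * C₂ * Δ) := by positivity
    by_cases hβΔ : β < Δ
    · have : I β ≤ I Δ := hImono β Δ hβΔ.le
      simp only [ha₀]
      linarith
    · push Not at hβΔ
      -- `I β - I Δ ≤ ∫_{[0,β]} G ≤ β (A + Cs C₂ Δ) + Cs ∫_{[0,β]} I`
      have h1 : 1 * ∫ s in Icc (0 + Δ) β, F s ≤ ∫ τ' in Icc 0 β, G τ' :=
        hlow 0 β 1 hβ.1 (Icc (0 + Δ) β) measurableSet_Icc
          (Icc_subset_Icc (by linarith) (by linarith [hβ.2])) (hbulk_weight 0 β)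
      rw [one_mul, zero_add, ← hIdiff Δ β hβΔ] at h1
      have h2 : ∫ τ' in Icc 0 β, G τ' ≤ ∫ τ' in Icc 0 β, ((A + Cs * C₂ * Δ) + Cs * I τ') :=
        setIntegral_mono_on (havg 0 β hβ.1).1
          ((continuousOn_const.add (continuousOn_const.mul hIc.continuousOn)).integrableOn_Icc)
          measurableSet_Icc fun τ' hτ' => hGle' τ' ⟨hτ'.1, hτ'.2.trans hβ.2⟩
      have h3 : ∫ τ' in Icc 0 β, ((A + Cs * C₂ * Δ) + Cs * I τ') =
          β * (A + Cs * C₂ * Δ) + Cs * ∫ τ' in (0 : ℝ)..β, I τ' := by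
        rw [integral_Icc_eq_integral_Ioc, ← intervalIntegral.integral_of_le hβ.1,
          intervalIntegral.integral_add intervalIntegrable_const ((hIi 0 β).const_mul Cs),
          intervalIntegral.integral_const, intervalIntegral.integral_const_mul, smul_eq_mul]
        ring
      have h4 : β * (A + Cs * C₂ * Δ) ≤ t * (A + Cs * C₂ * Δ) :=
        mul_le_mul_of_nonneg_right (by linarith [hβ.2]) (by positivity)
      linarith
  have hIbound : ∀ τ ∈ Icc 0 t, |I τ| ≤ C₂ * t := fun τ hτ => by
    rw [abs_of_nonneg (hInn τ hτ.1)]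
    have := hIlip 0 τ hτ.1; rw [hI0] at this
    nlinarith [hτ.2]
  have hgron := EntropicWeakStrong.gronwall_measurable_bounded hIc.measurable (by linarith : 0 ≤ t - Δ)
    ha₀nn hCs (fun τ hτ => hIbound τ ⟨hτ.1, hτ.2.trans (by linarith)⟩) hle
  set BI : ℝ := (C₂ * Δ + t * (A + Cs * C₂ * Δ)) * Real.exp (Cs * t) + C₂ * Δ with hBI
  have hIt : I t ≤ BI := by
    have h1 := hgron (t - Δ) ⟨by linarith, le_rfl⟩
    have h2 : a₀ * Real.exp (Cs * (t - Δ)) ≤ a₀ * Real.exp (Cs * t) :=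
      mul_le_mul_of_nonneg_left (Real.exp_le_exp.2 (by nlinarith)) ha₀nn
    have h3 := hIlip (t - Δ) t (by linarith)
    simp only [hBI, ha₀] at h1 h2 ⊢
    nlinarith
  have hIall : ∀ τ ∈ Icc 0 t, I τ ≤ BI := fun τ hτ => (hImono τ t hτ.2).trans hIt
  -- Step 2: the uniform bound `G ≤ Q` and the averaged bounds
  set Q : ℝ := A + Cs * BI with hQ
  have hBInn : 0 ≤ BI := (hInn t ht.le).trans hIt
  have hQnn : 0 ≤ Q := by positivity
  have hGQ : ∀ τ' ∈ Icc 0 (t - Δ), G τ' ≤ Q := fun τ' hτ' =>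
    (hGle τ' hτ').trans (by
      have := hIall (τ' + Δ) ⟨by linarith [hτ'.1], by linarith [hτ'.2]⟩
      simp only [hQ]; nlinarith)
  have havgQ : ∀ α β : ℝ, 0 ≤ α → α ≤ β → β ≤ t - Δ → ∫ τ' in Icc α β, G τ' ≤ (β - α) * Q :=
    fun α β hα hαβ hβ => hup α β Q hα hαβ hβ fun τ' hτ' => hGQ τ' ⟨hα.trans hτ'.1, hτ'.2.trans hβ⟩
  -- bulk estimate: `∫_{[α+Δ, β]} F ≤ (β - α) Q`
  have hbulk : ∀ α β : ℝ, 0 ≤ α → α + Δ ≤ β → β ≤ t - Δ →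
      ∫ s in Icc (α + Δ) β, F s ≤ (β - α) * Q := fun α β hα hαβ hβ => by
    have h1 := hlow α β 1 (by linarith) (Icc (α + Δ) β) measurableSet_Icc
      (Icc_subset_Icc (by linarith) (by linarith)) (hbulk_weight α β)
    rw [one_mul] at h1
    exact h1.trans (havgQ α β hα (by linarith) hβ)
  -- the two positive weights
  set m₀ : ℝ := 1 - Real.smoothTransition (1 - u) with hm₀
  set m₁ : ℝ := Real.smoothTransition u with hm₁
  have hm₀pos : 0 < m₀ := by
    simp only [hm₀, sub_pos]; exact Real.smoothTransition.lt_one_of_lt_one (by linarith)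
  have hm₁pos : 0 < m₁ := Real.smoothTransition.pos_of_pos hu0
  -- early edge: `∫_{[uΔ, Δ]} F ≤ Δ Q / m₀`
  have hearly : ∫ s in Icc (u * Δ) Δ, F s ≤ Δ * Q / m₀ := by
    have hw : ∀ s ∈ Icc (u * Δ) Δ, m₀ ≤ Real.smoothTransition ((Δ + Δ - s) / Δ) -
        Real.smoothTransition ((0 + Δ - s) / Δ) := fun s hs => by
      rw [hcut_one Δ s hs.2]
      have : Real.smoothTransition ((0 + Δ - s) / Δ) ≤ Real.smoothTransition (1 - u) :=
        Real.smoothTransition.monotone (by rw [div_le_iff₀ hΔ]; nlinarith [hs.1])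
      simp only [hm₀]; linarith
    have h1 := hlow 0 Δ m₀ hΔ.le (Icc (u * Δ) Δ) measurableSet_Icc
      (Icc_subset_Icc (by positivity) (by linarith)) hw
    have h2 := havgQ 0 Δ le_rfl hΔ.le (by linarith)
    rw [sub_zero] at h2
    rw [le_div_iff₀ hm₀pos]; nlinarith
  -- late edge: `∫_{[t-Δ, t-uΔ]} F ≤ Δ Q / m₁`
  have hlate : ∫ s in Icc (t - Δ) (t - u * Δ), F s ≤ Δ * Q / m₁ := by
    have hw : ∀ s ∈ Icc (t - Δ) (t - u * Δ), m₁ ≤ Real.smoothTransition ((t - Δ + Δ - s) / Δ) -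
        Real.smoothTransition ((t - 2 * Δ + Δ - s) / Δ) := fun s hs => by
      rw [hcut_zero (t - 2 * Δ) s (by linarith [hs.1]), sub_zero]
      exact Real.smoothTransition.monotone (by rw [le_div_iff₀ hΔ]; nlinarith [hs.2])
    have h1 := hlow (t - 2 * Δ) (t - Δ) m₁ (by linarith) (Icc (t - Δ) (t - u * Δ)) measurableSet_Icc
      (Icc_subset_Icc (by linarith) (by nlinarith)) hw
    have h2 := havgQ (t - 2 * Δ) (t - Δ) (by linarith) (by linarith) le_rfl
    have h3 : (t - Δ - (t - 2 * Δ)) * Q = Δ * Q := by ring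
    rw [h3] at h2
    rw [le_div_iff₀ hm₁pos]; nlinarith
  -- Step 3: the three kinds of windows
  intro τ₀ hτ₀
  have hsplit : ∀ a b c : ℝ, a ≤ b → b ≤ c →
      ∫ s in Icc a c, F s = (∫ s in Icc a b, F s) + ∫ s in Icc b c, F s := fun a b c hab hbc => by
    rw [← hIdiff a c (hab.trans hbc), ← hIdiff a b hab, ← hIdiff b c hbc]; ring
  have hmono_set : ∀ a b c d : ℝ, c ≤ a → b ≤ d →
      ∫ s in Icc a b, F s ≤ ∫ s in Icc c d, F s := fun a b c d hca hbd =>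
    setIntegral_mono_set (hFi _ measure_Icc_lt_top.ne)
      (Filter.Eventually.of_forall fun s => hF0 s) (Filter.Eventually.of_forall (Icc_subset_Icc hca hbd))
  have huΔle : u * Δ ≤ Δ := mul_le_of_le_one_left hΔ.le hu1.le
  have huΔnn : 0 ≤ u * Δ := by positivity
  have hQm₀ : 0 ≤ Δ * (Q / m₀) := mul_nonneg hΔ.le (div_nonneg hQnn hm₀pos.le)
  have hQm₁ : 0 ≤ Δ * (Q / m₁) := mul_nonneg hΔ.le (div_nonneg hQnn hm₁pos.le)
  have hC₂u : 0 ≤ C₂ * (u * Δ) := mul_nonneg hC₂ huΔnn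
  have hearly' : ∫ s in Icc (u * Δ) Δ, F s ≤ Δ * (Q / m₀) := by rw [← mul_div_assoc]; exact hearly
  have hlate' : ∫ s in Icc (t - Δ) (t - u * Δ), F s ≤ Δ * (Q / m₁) := by rw [← mul_div_assoc]; exact hlate
  have hfinal : ∫ s in Icc τ₀ (τ₀ + Δ), F s ≤ Δ * (2 * Q + Q / m₀ + Q / m₁ + C₂ * u) := by
    have e : Δ * (2 * Q + Q / m₀ + Q / m₁ + C₂ * u) =
        2 * Δ * Q + Δ * (Q / m₀) + Δ * (Q / m₁) + C₂ * (u * Δ) := by ring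
    rw [e]
    rcases lt_or_ge τ₀ Δ with hcase | hcase
    · -- early window
      have h1 : ∫ s in Icc τ₀ (τ₀ + Δ), F s ≤ ∫ s in Icc 0 (2 * Δ), F s :=
        hmono_set _ _ _ _ hτ₀.1 (by linarith)
      have h2 : ∫ s in Icc 0 (2 * Δ), F s = (∫ s in Icc 0 (u * Δ), F s) +
          (∫ s in Icc (u * Δ) Δ, F s) + ∫ s in Icc Δ (2 * Δ), F s := by
        rw [hsplit 0 Δ (2 * Δ) hΔ.le (by linarith), hsplit 0 (u * Δ) Δ huΔnn huΔle]
      have h3 : ∫ s in Icc 0 (u * Δ), F s ≤ C₂ * (u * Δ) := by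
        have := hwindow_le 0 (u * Δ) huΔnn; rwa [sub_zero] at this
      have h4 : ∫ s in Icc Δ (2 * Δ), F s ≤ (2 * Δ - 0) * Q := by
        have := hbulk 0 (2 * Δ) le_rfl (by linarith) (by linarith); rwa [zero_add] at this
      linarith
    · rcases le_or_gt τ₀ (t - 2 * Δ) with hcase' | hcase'
      · -- bulk window
        have h1 := hbulk (τ₀ - Δ) (τ₀ + Δ) (by linarith) (by linarith) (by linarith)
        have e1 : τ₀ - Δ + Δ = τ₀ := by ring
        have e2 : (τ₀ + Δ - (τ₀ - Δ)) * Q = 2 * Δ * Q := by ring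
        rw [e1, e2] at h1
        linarith
      · -- late window
        have h1 : ∫ s in Icc τ₀ (τ₀ + Δ), F s ≤ ∫ s in Icc (t - 2 * Δ) t, F s :=
          hmono_set _ _ _ _ hcase'.le (by linarith [hτ₀.2])
        have h2 : ∫ s in Icc (t - 2 * Δ) t, F s = (∫ s in Icc (t - 2 * Δ) (t - Δ), F s) +
            ((∫ s in Icc (t - Δ) (t - u * Δ), F s) + ∫ s in Icc (t - u * Δ) t, F s) := by
          rw [hsplit (t - 2 * Δ) (t - Δ) t (by linarith) (by linarith),
            hsplit (t - Δ) (t - u * Δ) t (by linarith) (by linarith)]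
        have h3 : ∫ s in Icc (t - u * Δ) t, F s ≤ C₂ * (u * Δ) := by
          have := hwindow_le (t - u * Δ) t (by linarith)
          have e3 : t - (t - u * Δ) = u * Δ := by ring
          rwa [e3] at this
        have h4 : ∫ s in Icc (t - 2 * Δ) (t - Δ), F s ≤ 2 * Δ * Q := by
          have := hbulk (t - 3 * Δ) (t - Δ) (by linarith) (by linarith) le_rfl
          have e3 : t - 3 * Δ + Δ = t - 2 * Δ := by ring
          have e4 : (t - Δ - (t - 3 * Δ)) * Q = 2 * Δ * Q := by ring
          rwa [e3, e4] at this
        linarith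
  have hcoef : Δ * (2 * Q + Q / m₀ + Q / m₁ + C₂ * u) =
      Δ * ((2 + 1 / (1 - Real.smoothTransition (1 - u)) + 1 / Real.smoothTransition u) * Q +
        C₂ * u) := by
    simp only [hm₀, hm₁]; ring
  rw [← hcoef]
  exact hfinal

/-- **The windowed Grönwall lemma.** Let `F` be measurable with `0 ≤ F ≤ C₂` on `[0, t]`, `0 < Δ`, `4Δ ≤ t`,
`A, C⋆ ≥ 0`, `u ∈ (0,1)`, and suppose that for every window start `τ₀ ∈ [0, t − Δ]`
`∫_{[0,t]} w_{τ₀} F ≤ A + C⋆ ∫_{[0, τ₀+Δ]} F` with `w_{τ₀}(s) = −∂ₛ ζ((τ₀ + Δ − s)/Δ)`, `ζ = Real.smoothTransition`.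
Then for every such `τ₀`,
`∫_{[τ₀, τ₀+Δ]} F ≤ Δ·[(2 + 1/(1 − ζ(1−u)) + 1/ζ(u))·(A + C⋆((C₂Δ + t(A + C⋆C₂Δ))e^{C⋆t} + C₂Δ)) + C₂u]`.
[folklore] -/
theorem window_gronwall {F : ℝ → ℝ} (hF : Measurable F) {t Δ A Cs C₂ u : ℝ}
    (hΔ : 0 < Δ) (hΔt : 4 * Δ ≤ t) (hA : 0 ≤ A) (hCs : 0 ≤ Cs) (hC₂ : 0 ≤ C₂)
    (hu0 : 0 < u) (hu1 : u < 1) (hF0 : ∀ s ∈ Icc 0 t, 0 ≤ F s) (hFb : ∀ s ∈ Icc 0 t, F s ≤ C₂)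
    (hwin : ∀ τ₀ ∈ Icc 0 (t - Δ),
      ∫ s in Icc 0 t, -deriv (fun s' => Real.smoothTransition ((τ₀ + Δ - s') / Δ)) s * F s
        ≤ A + Cs * ∫ s in Icc 0 (τ₀ + Δ), F s) :
    ∀ τ₀ ∈ Icc 0 (t - Δ), ∫ s in Icc τ₀ (τ₀ + Δ), F s ≤
      Δ * ((2 + 1 / (1 - Real.smoothTransition (1 - u)) + 1 / Real.smoothTransition u) *
        (A + Cs * ((C₂ * Δ + t * (A + Cs * C₂ * Δ)) * Real.exp (Cs * t) + C₂ * Δ)) + C₂ * u) := by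
  set Ft : ℝ → ℝ := (Icc 0 t).indicator F with hFt
  have hFtm : Measurable Ft := hF.indicator measurableSet_Icc
  have hFt0 : ∀ s, 0 ≤ Ft s := fun s => by
    by_cases hs : s ∈ Icc 0 t
    · simp only [hFt, indicator_of_mem hs]; exact hF0 s hs
    · simp only [hFt, indicator_of_notMem hs]; exact le_rfl
  have hFtb : ∀ s, Ft s ≤ C₂ := fun s => by
    by_cases hs : s ∈ Icc 0 t
    · simp only [hFt, indicator_of_mem hs]; exact hFb s hs
    · simp only [hFt, indicator_of_notMem hs]; exact hC₂
  have hcongr : ∀ a b : ℝ, Icc a b ⊆ Icc 0 t → ∀ g : ℝ → ℝ,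
      ∫ s in Icc a b, g s * Ft s = ∫ s in Icc a b, g s * F s := fun a b hab g =>
    setIntegral_congr_fun measurableSet_Icc fun s hs => by
      simp only [hFt, indicator_of_mem (hab hs)]
  have hcongr1 : ∀ a b : ℝ, Icc a b ⊆ Icc 0 t → ∫ s in Icc a b, Ft s = ∫ s in Icc a b, F s :=
    fun a b hab => by simpa using hcongr a b hab (fun _ => 1)
  have hwin' : ∀ τ₀ ∈ Icc 0 (t - Δ),
      ∫ s in Icc 0 t, -deriv (fun s' => Real.smoothTransition ((τ₀ + Δ - s') / Δ)) s * Ft s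
        ≤ A + Cs * ∫ s in Icc 0 (τ₀ + Δ), Ft s := fun τ₀ hτ₀ => by
    rw [hcongr 0 t subset_rfl, hcongr1 0 (τ₀ + Δ) (Icc_subset_Icc le_rfl (by linarith [hτ₀.2]))]
    exact hwin τ₀ hτ₀
  intro τ₀ hτ₀
  rw [← hcongr1 τ₀ (τ₀ + Δ) (Icc_subset_Icc hτ₀.1 (by linarith [hτ₀.2]))]
  exact window_gronwall_core hFtm hΔ hΔt hA hCs hC₂ hu0 hu1 hFt0 hFtb hwin' τ₀ hτ₀

/-- REGISTERED SUB-GOAL `stub_bf18ShellWindow` of the line `Sketch` (helper 2 of `stub_bf18Shell`): the windowed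
Grönwall lemma, all hypotheses explicit. [folklore] -/
theorem stub_bf18ShellWindow :
    ∀ (F : ℝ → ℝ) (t Δ A Cs C₂ u : ℝ), Measurable F → 0 < Δ → 4 * Δ ≤ t → 0 ≤ A → 0 ≤ Cs → 0 ≤ C₂ →
      0 < u → u < 1 → (∀ s ∈ Set.Icc 0 t, 0 ≤ F s) → (∀ s ∈ Set.Icc 0 t, F s ≤ C₂) →
      (∀ τ₀ ∈ Set.Icc 0 (t - Δ),
        ∫ s in Set.Icc 0 t, -deriv (fun s' => Real.smoothTransition ((τ₀ + Δ - s') / Δ)) s * F s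
          ≤ A + Cs * ∫ s in Set.Icc 0 (τ₀ + Δ), F s) →
      ∀ τ₀ ∈ Set.Icc 0 (t - Δ), ∫ s in Set.Icc τ₀ (τ₀ + Δ), F s ≤
        Δ * ((2 + 1 / (1 - Real.smoothTransition (1 - u)) + 1 / Real.smoothTransition u) *
          (A + Cs * ((C₂ * Δ + t * (A + Cs * C₂ * Δ)) * Real.exp (Cs * t) + C₂ * Δ)) + C₂ * u) :=
  fun _F _t _Δ _A _Cs _C₂ _u hF hΔ hΔt hA hCs hC₂ hu0 hu1 hF0 hFb hwin =>
    window_gronwall hF hΔ hΔt hA hCs hC₂ hu0 hu1 hF0 hFb hwin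

end Summit.AtomisticToContinuum.HydrodynamicLimit.Theorems.ChaosClosesEulerShell
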